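import Mathlib
import Literature.Analysis.FluidPDE.SelfSimilar
import Literature.Analysis.FluidPDE.TypeIAncientMild
import Literature.Analysis.FluidPDE.CurlFreeLiouville
import Summits.NavierStokesRegularity.NavierStokesRegularity.Theorems.SymmetryModuliCountStretchingCertificateComparison
import Summits.NavierStokesRegularity.NavierStokesRegularity.Theorems.DssFarFieldSlavingBlowupTypeIDssProfileSmoothRepresentativeAe
import HarnessLib

/-!
# A time-weighted strain budget kills Type-I ancient mild solutions (pub-ns-dss: T32′-type statements as a tree theorem)
  (route `DssFarFieldSlaving`, crux `BlowupTypeIDssProfile`, stmt-NavierStokesRegularity-0155 — SUPPORT;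
  cell pub-ns-dss, typer seat g3; strengthening of `SubcriticalStrain.typeI_ancient_subcriticalStrain_eq_zero`
  (T32: constant budget) offered to the theory seat, whose T32′ («for s-periodic members the period average of
  sup_y λ_max(S̃) is ≥ 1») is the periodic reading of the statement below.)

HONEST FRAMING. A composition of tree theorems (route SymmetryModuliCount's stretching-certificate maximum
principle with a weight depending on TIME ONLY, KNSS 2009 Lemma 3.1 / Remark 6.1); no new analysis; nothing here
is a statement about Navier–Stokes regularity or blow-up; an empty cell is a solver control / diagnosis.

`typeI_ancient_eq_zero_of_strainBudget`: let `V` be a Type-I ancient mild field in the KNSS gauge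
(`IsTypeIAncientMild C V`, any `C`), `δ > 0`, and `g : ℝ → ℝ` smooth ON `t < 0` with `g(t) ≥ 0` there. If for all
`t < 0`, `x`, `ξ`: `⟪∇V(t,x) ξ, ξ⟫ ≤ ((1 − δ)/(−t) + g′(t)) ‖ξ‖²` — i.e. in similarity time `s = −log(−t)` the
excess of `sup_y λ_max(S̃(s))` over `1 − δ` is paid for by the increase of the non-negative budget `G(s) = g(t)`,
`sup_y λ_max(S̃(s)) ≤ 1 − δ + dG/ds` — then `V ≡ 0` on `t < 0`. The constant budget `g ≡ 0` is T32
(`(−t) λ_max(S) ≤ Λ = 1 − δ < 1`). PROOF: the weight `h(t,x) = exp(g(t)) ≥ 1` has `∇ₓh = 0`, `Δh = 0`,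
`∂ₜh = g′ h`, so the certificate inequality `((−t)(⟪∇V ξ,ξ⟫ − |∇ξ|²) − 1 + δ) h ≤ (−t)(∂ₜh + V·∇h − Δh)`
reduces to `(−t)⟪∇V ξ, ξ⟫ − 1 + δ ≤ (−t) g′(t)` for the unit vector `ξ = ω/|ω|`; `stretchCert_curl_eq_zero`
gives `curl V ≡ 0`, and the KNSS endings conclude as in T32. The budget `g` is required to be smooth on `t < 0`
ONLY (it may oscillate or blow up as `t ↑ 0`; theory seat g5 vet 2026-08-22): this is what lets the PERIODIC
reading through — for a smooth `L`-periodic majorant `Λ̄(s) ≥ sup_y λ_max(S̃(·,s))` with period mean `m < 1` take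
`δ := 1 − m` and `G :=` the zero-mean primitive of `Λ̄ − m` minus its minimum (smooth, periodic, `≥ 0`), so that
`G′ = Λ̄ − 1 + δ` exactly and `g(t) := G(−log(−t))` satisfies `((1−δ)/(−t) + g′(t))‖ξ‖² = (Λ̄(s)/(−t))‖ξ‖²` —
the theory seat's T32′/T35′; that bookkeeping (the periodic corollary) is NOT done in this file, where the budget
`g` is a hypothesis.
[cite: KochNadirashviliSereginSverak2009, Lemma 3.1 and Remark 6.1 (arXiv:0709.3599)]
[cite: ConstantinFefferman1993, §1]
-/

noncomputable section

set_option linter.dupNamespace false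

namespace Summit.NavierStokesRegularity.NavierStokesRegularity.Theorems.SubcriticalStrain

open Set Function Filter MeasureTheory
open scoped RealInnerProductSpace Laplacian ContDiff Topology
open Literature.Analysis Literature.Analysis.FluidPDE
open Summit.NavierStokesRegularity.NavierStokesRegularity.Theorems

/-- **Certificate inequality for the time-only weight `exp (g t)` under a strain budget.** If
`⟪L ξ, ξ⟫ ≤ ((1 − δ)/(−t) + g') ‖ξ‖²` for a unit vector `ξ` (`t < 0`), then for all `F ≥ 0` and `e > 0`,
`((−t)(⟪L ξ, ξ⟫ − F) − 1 + δ) · e ≤ (−t) · (e · g' + 0 − 0)`. [folklore] -/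
theorem budget_cert_ineq {t δ g' e : ℝ} (ht : t < 0) (he : 0 < e)
    {L : EuclideanSpace ℝ (Fin 3) →L[ℝ] EuclideanSpace ℝ (Fin 3)} {ξ : EuclideanSpace ℝ (Fin 3)}
    (hξ : ‖ξ‖ = 1) (hL : ⟪L ξ, ξ⟫ ≤ ((1 - δ) / (-t) + g') * ‖ξ‖ ^ 2) {F : ℝ} (hF : 0 ≤ F) :
    ((-t) * (⟪L ξ, ξ⟫ - F) - 1 + δ) * e ≤ (-t) * (e * g' + 0 - 0) := by
  have ht0 : 0 < -t := neg_pos.2 ht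
  have htne : (-t) ≠ 0 := ht0.ne'
  have h1 : (-t) * ⟪L ξ, ξ⟫ ≤ (1 - δ) + (-t) * g' := by
    have e1 : (-t) * (((1 - δ) / (-t) + g') * ‖ξ‖ ^ 2) = (1 - δ) + (-t) * g' := by
      rw [hξ, one_pow, mul_one, mul_add, ← mul_div_assoc, mul_div_cancel_left₀ (1 - δ) htne]
    calc (-t) * ⟪L ξ, ξ⟫ ≤ (-t) * (((1 - δ) / (-t) + g') * ‖ξ‖ ^ 2) :=
          mul_le_mul_of_nonneg_left hL ht0.le
      _ = (1 - δ) + (-t) * g' := e1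
  have h2 : (-t) * (⟪L ξ, ξ⟫ - F) - 1 + δ ≤ (-t) * g' := by nlinarith [mul_nonneg ht0.le hF]
  have h3 : ((-t) * (⟪L ξ, ξ⟫ - F) - 1 + δ) * e ≤ ((-t) * g') * e :=
    mul_le_mul_of_nonneg_right h2 he.le
  calc ((-t) * (⟪L ξ, ξ⟫ - F) - 1 + δ) * e ≤ ((-t) * g') * e := h3
    _ = (-t) * (e * g' + 0 - 0) := by ring

/-- **A time-weighted strain budget kills Type-I ancient mild solutions** (T32′-type; T32 is `g ≡ 0`).
`IsTypeIAncientMild C V`, `δ > 0`, `g` smooth on `t < 0` with `g ≥ 0` there, and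
`⟪∇V(t,x) ξ, ξ⟫ ≤ ((1 − δ)/(−t) + g′(t)) ‖ξ‖²` for all `t < 0`, `x`, `ξ` ⇒ `V ≡ 0` on `t < 0`. Proof: the
weight `exp ∘ g` (time only) is a stretching certificate (`budget_cert_ineq`), so `curl V ≡ 0`
(`stretchCert_curl_eq_zero`); then `eq_of_curl_eq_zero_of_isDivFree_of_bounded` and
`IsTypeIAncientMild.eq_zero_of_slice_const`. [cite: KochNadirashviliSereginSverak2009, Lemma 3.1 and Remark 6.1 (arXiv:0709.3599)] -/
theorem typeI_ancient_eq_zero_of_strainBudget {C δ : ℝ} (hδ : 0 < δ)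
    {g : ℝ → ℝ} (hg : ContDiffOn ℝ (⊤ : ℕ∞) g (Iio 0)) (hg0 : ∀ t < 0, 0 ≤ g t)
    {V : ℝ → EuclideanSpace ℝ (Fin 3) → EuclideanSpace ℝ (Fin 3)} (hV : IsTypeIAncientMild C V)
    (hstrain : ∀ t < 0, ∀ x ξ : EuclideanSpace ℝ (Fin 3),
      ⟪fderiv ℝ (V t) x ξ, ξ⟫ ≤ ((1 - δ) / (-t) + deriv g t) * ‖ξ‖ ^ 2) :
    ∀ t < 0, ∀ x, V t x = 0 := by
  intro t ht x
  -- the time-only certificate `h t x = exp (g t)`, `A = 0`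
  set h : ℝ → EuclideanSpace ℝ (Fin 3) → ℝ := fun s _ => Real.exp (g s) with hdef
  have hgd : ∀ s < (0:ℝ), DifferentiableAt ℝ g s := fun s hs =>
    (hg.differentiableOn (by simp)).differentiableAt (Iio_mem_nhds hs)
  have hh : IsSmoothSpaceTimeOn (Iio 0) h := by
    have : ContDiffOn ℝ (⊤ : ℕ∞) (fun p : ℝ × EuclideanSpace ℝ (Fin 3) => Real.exp (g p.1))
        (Iio 0 ×ˢ univ) :=
      Real.contDiff_exp.comp_contDiffOn (hg.comp contDiffOn_fst fun p hp => hp.1)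
    exact this
  have hh1 : ∀ s < (0 : ℝ), ∀ (y : EuclideanSpace ℝ (Fin 3)), 1 ≤ h s y := fun s hs _ =>
    Real.one_le_exp (hg0 s hs)
  have hgrad1 : ∀ s < (0 : ℝ), ∀ (y : EuclideanSpace ℝ (Fin 3)),
      ‖fderiv ℝ (h s) y‖ ≤ 0 * (1 / Real.sqrt (-s) + ‖y‖ / (-s)) * h s y := by
    intro s _ y
    simp [hdef]
  have hcert : ∀ s < (0 : ℝ), ∀ (y : EuclideanSpace ℝ (Fin 3)), curl (V s) y ≠ 0 →
      ((-s) * (⟪fderiv ℝ (V s) y (vorticityDirection (curl (V s)) y),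
          vorticityDirection (curl (V s)) y⟫
          - frobeniusNormSq (fderiv ℝ (vorticityDirection (curl (V s))) y)) - 1 + δ) * h s y ≤
        (-s) * (timeDeriv h s y + fderiv ℝ (h s) y (V s y) - (Δ (h s)) y) := by
    intro s hs y hω
    have hξ : ‖vorticityDirection (curl (V s)) y‖ = 1 := by
      rw [vorticityDirection_apply, norm_smul, norm_inv, norm_norm,
        inv_mul_cancel₀ (norm_ne_zero_iff.2 hω)]
    have htd : timeDeriv h s y = Real.exp (g s) * deriv g s := by
      simp only [timeDeriv, hdef]
      exact ((Real.hasDerivAt_exp (g s)).comp s (hgd s hs).hasDerivAt).deriv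
    have hfd : fderiv ℝ (h s) y (V s y) = 0 := by
      simp [hdef]
    have hΔ : (Δ (h s)) y = 0 := laplacian_const_eq_zero (Real.exp (g s)) y
    rw [htd, hfd, hΔ]
    exact budget_cert_ineq hs (Real.exp_pos _) hξ (hstrain s hs y _) (frobeniusNormSq_nonneg _)
  have hω : ∀ s < 0, ∀ y, curl (V s) y = 0 := fun s hs y =>
    stretchCert_curl_eq_zero hV hh hh1 hδ hgrad1 hcert hs y
  have hub : ∀ s < 0, ∀ y, V s y = V s 0 := fun s hs y =>
    eq_of_curl_eq_zero_of_isDivFree_of_bounded ((hV.contDiff_slice hs).of_le (by norm_cast))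
      (hω s hs) (hV.isDivFree hs) (fun z => hV.norm_le hs z) y 0
  exact hV.eq_zero_of_slice_const hub ht x

/-- **Certificate-defect budget (the direction term kept; T35 with a time budget).** Same as
`typeI_ancient_eq_zero_of_strainBudget` but with Constantin–Fefferman's direction term retained: if at
every vorticity-carrying point `(−t)(⟪∇V ξ, ξ⟫ − |∇ξ|²_F) ≤ 1 − δ + (−t) g′(t)` for the vorticity
direction `ξ = ω/|ω|` (`δ > 0`, `g` smooth on `t < 0`, `g ≥ 0` there), then `V ≡ 0` on `t < 0`. The theory
seat's T35 is `g ≡ 0`; its period-mean form T35′ is the periodic reading (budget bookkeeping not done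
here). Proof: the weight `exp ∘ g` in `stretchCert_curl_eq_zero`, then KNSS 3.1 / 6.1. [cite: KochNadirashviliSereginSverak2009, Lemma 3.1 and Remark 6.1 (arXiv:0709.3599)] -/
theorem typeI_ancient_eq_zero_of_certificateBudget {C δ : ℝ} (hδ : 0 < δ)
    {g : ℝ → ℝ} (hg : ContDiffOn ℝ (⊤ : ℕ∞) g (Iio 0)) (hg0 : ∀ t < 0, 0 ≤ g t)
    {V : ℝ → EuclideanSpace ℝ (Fin 3) → EuclideanSpace ℝ (Fin 3)} (hV : IsTypeIAncientMild C V)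
    (hcert : ∀ t < 0, ∀ x, curl (V t) x ≠ 0 →
      (-t) * (⟪fderiv ℝ (V t) x (vorticityDirection (curl (V t)) x), vorticityDirection (curl (V t)) x⟫
        - frobeniusNormSq (fderiv ℝ (vorticityDirection (curl (V t))) x)) ≤ 1 - δ + (-t) * deriv g t) :
    ∀ t < 0, ∀ x, V t x = 0 := by
  intro t ht x
  set h : ℝ → EuclideanSpace ℝ (Fin 3) → ℝ := fun s _ => Real.exp (g s) with hdef
  have hgd : ∀ s < (0:ℝ), DifferentiableAt ℝ g s := fun s hs =>
    (hg.differentiableOn (by simp)).differentiableAt (Iio_mem_nhds hs)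
  have hh : IsSmoothSpaceTimeOn (Iio 0) h := by
    have : ContDiffOn ℝ (⊤ : ℕ∞) (fun p : ℝ × EuclideanSpace ℝ (Fin 3) => Real.exp (g p.1))
        (Iio 0 ×ˢ univ) :=
      Real.contDiff_exp.comp_contDiffOn (hg.comp contDiffOn_fst fun p hp => hp.1)
    exact this
  have hh1 : ∀ s < (0 : ℝ), ∀ (y : EuclideanSpace ℝ (Fin 3)), 1 ≤ h s y := fun s hs _ =>
    Real.one_le_exp (hg0 s hs)
  have hgrad1 : ∀ s < (0 : ℝ), ∀ (y : EuclideanSpace ℝ (Fin 3)),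
      ‖fderiv ℝ (h s) y‖ ≤ 0 * (1 / Real.sqrt (-s) + ‖y‖ / (-s)) * h s y := by
    intro s _ y
    simp [hdef]
  have hcert' : ∀ s < (0 : ℝ), ∀ (y : EuclideanSpace ℝ (Fin 3)), curl (V s) y ≠ 0 →
      ((-s) * (⟪fderiv ℝ (V s) y (vorticityDirection (curl (V s)) y),
          vorticityDirection (curl (V s)) y⟫
          - frobeniusNormSq (fderiv ℝ (vorticityDirection (curl (V s))) y)) - 1 + δ) * h s y ≤
        (-s) * (timeDeriv h s y + fderiv ℝ (h s) y (V s y) - (Δ (h s)) y) := by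
    intro s hs y hω
    have htd : timeDeriv h s y = Real.exp (g s) * deriv g s := by
      simp only [timeDeriv, hdef]
      exact ((Real.hasDerivAt_exp (g s)).comp s (hgd s hs).hasDerivAt).deriv
    have hfd : fderiv ℝ (h s) y (V s y) = 0 := by
      simp [hdef]
    have hΔ : (Δ (h s)) y = 0 := laplacian_const_eq_zero (Real.exp (g s)) y
    rw [htd, hfd, hΔ]
    have he : 0 < Real.exp (g s) := Real.exp_pos _
    have hs0 : 0 < -s := neg_pos.2 hs
    have h2 := hcert s hs y hω
    have h3 : ((-s) * (⟪fderiv ℝ (V s) y (vorticityDirection (curl (V s)) y),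
          vorticityDirection (curl (V s)) y⟫
          - frobeniusNormSq (fderiv ℝ (vorticityDirection (curl (V s))) y)) - 1 + δ) * Real.exp (g s) ≤
        ((-s) * deriv g s) * Real.exp (g s) :=
      mul_le_mul_of_nonneg_right (by linarith) he.le
    calc _ ≤ ((-s) * deriv g s) * Real.exp (g s) := h3
      _ = (-s) * (Real.exp (g s) * deriv g s + 0 - 0) := by ring
  have hω : ∀ s < 0, ∀ y, curl (V s) y = 0 := fun s hs y =>
    stretchCert_curl_eq_zero hV hh hh1 hδ hgrad1 hcert' hs y
  have hub : ∀ s < 0, ∀ y, V s y = V s 0 := fun s hs y =>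
    eq_of_curl_eq_zero_of_isDivFree_of_bounded ((hV.contDiff_slice hs).of_le (by norm_cast))
      (hω s hs) (hV.isDivFree hs) (fun z => hV.norm_le hs z) y 0
  exact hV.eq_zero_of_slice_const hub ht x

/-- **CLASS level: the strain-budget cell of the hypothesis class of `RdssProfileTruncation` is EMPTY.**
For every Type-I bound `M`, every `δ > 0` and every budget `g` smooth and `≥ 0` on `t < 0` there is no member
(any factor `c > 1`, any twist `R`) all of whose smooth Type-I representatives `V` (`IsTypeIAncientMild M V`,
`V t =ᵐ u t`) satisfy `⟪∇V(t,x) ξ, ξ⟫ ≤ ((1 − δ)/(−t) + g′(t)) ‖ξ‖²`; representatives quantified as in the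
E23/E24 wrappers (the class speaks about an a.e. object). `g ≡ 0`, `δ = 1 − Λ` is
`SubcriticalStrain.rdssClass_subcriticalStrain_empty`. [this file]
[cite: KochNadirashviliSereginSverak2009, Lemma 3.1 and Remark 6.1 (arXiv:0709.3599)] -/
theorem rdssClass_strainBudget_empty (M : ℝ) {δ : ℝ} (hδ : 0 < δ)
    {g : ℝ → ℝ} (hg : ContDiffOn ℝ (⊤ : ℕ∞) g (Iio 0)) (hg0 : ∀ t < 0, 0 ≤ g t) :
    ¬ ∃ (c : ℝ) (R : (EuclideanSpace ℝ (Fin 3)) ≃ₗᵢ[ℝ] (EuclideanSpace ℝ (Fin 3)))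
        (u : ℝ → (EuclideanSpace ℝ (Fin 3)) → (EuclideanSpace ℝ (Fin 3))),
      1 < c ∧ IsAncientMildSolution 1 u ∧ (∀ t < 0, AEStronglyMeasurable (u t) volume) ∧
      IsRotatedDSS c R u ∧ HasTypeIDecay M u ∧
      (∀ V : ℝ → EuclideanSpace ℝ (Fin 3) → EuclideanSpace ℝ (Fin 3), IsTypeIAncientMild M V →
        (∀ t < 0, V t =ᵐ[volume] u t) →
        ∀ t < 0, ∀ x ξ : EuclideanSpace ℝ (Fin 3),
          ⟪fderiv ℝ (V t) x ξ, ξ⟫ ≤ ((1 - δ) / (-t) + deriv g t) * ‖ξ‖ ^ 2) ∧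
      ¬ (∀ t < 0, u t =ᵐ[volume] 0) := by
  rintro ⟨c, R, u, -, hmild, hmeas, -, hdec, hstrain, hne⟩
  obtain ⟨V, hT, -, hVu, -⟩ := typeI_ancient_smoothRepresentative_ae hmild hmeas hdec
  have hz : ∀ t < 0, ∀ x, V t x = 0 :=
    typeI_ancient_eq_zero_of_strainBudget hδ hg hg0 hT (hstrain V hT hVu)
  refine hne fun t ht => ?_
  have hVz : V t = 0 := funext fun x => by simpa using hz t ht x
  exact (hVu t ht).symm.trans (Filter.EventuallyEq.of_eq hVz)

end Summit.NavierStokesRegularity.NavierStokesRegularity.Theorems.SubcriticalStrain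

end
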